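import Summits.BirchSwinnertonDyer.Rank1Residual.ManinAdditive.NineShiftEqualiserLaw
import Summits.BirchSwinnertonDyer.BirchSwinnertonDyer.Theorems.ManinLocalTwoThreeNineShiftTowerReduction
import HarnessLib
import HarnessLib.Audit.Tags

/-!
# FINE REDUCTION of the 9-shift equaliser law E-es-94♯ to five single-step PAPER THEOREMS: E-es-102 … E-es-106
# (es g23, MEMO-es §37.9; cell `bsd-f2-manin`, T-es-31, typer g16; sibling of `NineShiftEqualiserLaw.lean`)

HONEST FRAMING.  LENS = Eisenstein-series / Γ₀-side (`bsd-f2-manin-es` g23, MEMO-es §37.9, MEMO sha16 82cd8f209dfa7717;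
HOME/es/g23/memo37_9.md dcac25ee29088f24).  SOURCE = HOME/es/NineShiftFineReduction-es-g23.lean sha16 **85b796e2cc4442c6**
(179 l.; = §FineReduction of HOME/es/Sketch-es-g23.lean 64711cee741460d4; `import …NineShiftEqualiserLaw` only; farm rc 0 · 0 err ·
0 warn · 0 sorry per es; BC7 5/5 CLEAN HOME/es/g23/bc7-g23f.raw.txt 2eaff5efab49a4ef), landed VERBATIM except: (i) this header;
(ii) a SIBLING module instead of an append (`NineShiftEqualiserLaw.lean` is at 367/400 lines), same namespace
`…ManinAdditive.NineShiftEqualiser`; (iii) the five rows carry `@[conjecture]` (obligation nodes, NOTHING asserted) and a TYPER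
FRAMING sentence; (iv) es's helpers `isDiamondChar_of_restrictsFrom` / `eq_zero_of_restrictsFrom_zero` are NOT re-declared — the
prover seat p3 g10 landed them (same statements) in `Theorems/ManinLocalTwoThreeNineShiftTowerReduction.lean` together with
**`towerReduction_holds : TowerReduction`** (E-es-101 PROVED, P-es-1 done), so this file `open`s that namespace, drops es's then-unused
`exists_g0Of_eq`, `intCast_zmod_eq_one/zero_of_dvd` (tree: p3's `g0Of_entries`, `intCast_zmod_eq_of_dvd`), keeps `restrictsFrom_trans`, and ADDS the glue-free corollary
`nineShiftInvariantIsDiamond_of_fine'` (E-es-94♯ ⟸ THEOREM III ∧ the five, the glue E-es-101 discharged by name).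

WHAT IS CLAIMED (es, not the tree).  Each of the five rows is a THEOREM ON PAPER (MEMO-es §37.9; referee R-es-48 PENDING):
* E-es-102 `ThreeShiftBasePrimeToThree` = THEOREM II(t = 3): `K₃^grp(N₀) = D^grp(N₀)`, `K₃^-(N₀) = 0` for `3 ∤ N₀` (Serre's amalgam
  `SL₂(ℤ[1/3]) = SL₂(ℤ) *_{Γ₀(3)} SL₂(ℤ)^{diag(3,1)}` + the congruence subgroup property of `SL₂(ℤ[1/3])`; REF1 §R97 PASS; the tree
  PROVES the CSP: `Literature…SerreSL2Congruence1970_congruenceSubgroupProperty_away_holds`);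
* E-es-103 `CubeStepDescent` = THEOREM IV and E-es-104 `CubeStepAntiDescent` = THEOREM IV⁻ (cube coset graph, `ω = 1` by hand, explicit
  new pair `(0, ab mod 3)`, two evaluations at `P_{1/M}` and `T`);
* E-es-105 `ThreeShiftStepNine` (Bass–Serre `h ≤ ω(K_{3,3}) = 1` + dimension count);
* E-es-106 `ThreeShiftAntiInvariantDescentAll` = THEOREMS V + III″ (anti-descent at EVERY `3 ∣ M` via the two-cusp functional;
  supersedes E-es-99 `ThreeShiftAntiInvariantDescent`, which `fine_reduction` re-derives from it).
PROVED HERE (sorry-free, es): `fine_reduction` (five ⟹ E-es-100a ∧ E-es-100b ∧ E-es-99), `nineShiftInvariantIsDiamond_of_fine`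
(TowerReduction → III → five → E-es-94♯); typer: `nineShiftInvariantIsDiamond_of_fine'` (III → five → E-es-94♯, using p3's
`towerReduction_holds`).  So, in the kernel: **E-es-94♯ `NineShiftInvariantIsDiamond` ⟸ {E-es-98 (III), E-es-102 … E-es-106}**, six
obligation nodes, each a paper theorem per es.
BC5 (census witness): HOME/es/g23b/CUBE-ANTI-CENSUS-v1.txt 5e005baed8d9929c — IV identities 81/81 at `3 ∤ M ≤ 121`; `(ε,κ)` table 54/54 at
`3 ∥ M ≤ 243` and 27/27 at `9 ∣ M ≤ 243`; `κ₊ ∉ Im R₊` 19/19; `∂(χ₉∘d)` 12/12; width-divisor law 15/15; `ω` by a second engine (scripts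
cubedual 850479d7bc0b34e1, widthtest 9b7c8092d31ce057, antitest 14fc1dc6e9aa831d, antidual 1d772d9688f6178f, verify6 69bbb1015ec374f8,
omega_cube 9a533a40021c5885); ENGINE 5 HOME/es/g23b/ENGINE5-PAIRSPACE-CENSUS-v1.txt 0492a4ed8104bba2 Tables A–D.  0 violations.
NOT IN PRINT (es; ref2 placement R-es-46/46′ pending): the Ihara-type statement at `ℓ = 3 ∣ N` INCLUDING the Eisenstein part; nearest
print = Ihara's lemma at `ℓ ∤ N` [Ribet 1984 ICM] and the amalgam method with trivial `𝔽₃` coefficients (CDT p. 549).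
REFUTER VERDICTS: R-es-48 (referee of §37.9) PENDING at filing; BC7 5/5 CLEAN (es).  bears_on: stmt-BirchSwinnertonDyer-22968 (C3
`ManinPrimeToThreeAtNine`: es-input `NineShiftInvariantIsDiamond` ⟹ (H₉ mod 3) `ClassLoopSpanLawNineMod3` on paper ⟹
`DegeneracyClassPlusIndexPrimeTo f 3 9` ⟹ THEOREM U♮ ⟹ `ThreeAdicPolarWitness` on the squarefull locus, tree files
`DegeneracyOrbitCriterion.lean`, `DegeneracyClassEulerUnitTwist.lean`).
PARTITION (es) 0 · beyond-print theorem: on paper yes (E-es-94♯, referee pending), in Lean no · BSD is not proved by this; Manin's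
law `c ∈ {±1}` is not proved by this; C3 stays OPEN.
-/

/-!
## es's sketch docstring (verbatim)
# es g23 — FINE REDUCTION of the 9-shift equaliser law E-es-94♯ (cell bsd-f2-manin, seat -es; MEMO-es §37.9)

Appends to `NineShiftEqualiserLaw.lean` (tree, p675032 + p676831) the five single-step statements
E-es-102 … E-es-106 — each a THEOREM ON PAPER (MEMO-es §37.9: base II(t=3) via Serre's tree + CSP; cube step IV /
IV⁻ with the explicit new pair `(0, ab mod 3)`; step nine by `h ≤ ω(K_{3,3}) = 1`; anti-descent V + III″ by the
two-cusp functional) — and the PROVED glue `fine_reduction` / `nineShiftInvariantIsDiamond_of_fine`: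
E-es-94♯ `NineShiftInvariantIsDiamond` ⟸ TowerReduction (E-es-101, glue) ∧ ThreeShiftTowerDescent (III) ∧ the five.
CENSUS (BC5): HOME/es/g23b/CUBE-ANTI-CENSUS-v1.txt, ENGINE 5 tables A–D.  PARTITION 0 · beyond-print theorem: on
paper yes (E-es-94♯, referee pending), in Lean no · BSD is not proved by this; Manin's conjecture is not proved by this.
-/

namespace Summit.BirchSwinnertonDyer.Rank1Residual.ManinAdditive.NineShiftEqualiser

open Matrix CongruenceSubgroup
open scoped MatrixGroups
open Summit.BirchSwinnertonDyer.BirchSwinnertonDyer.Theorems.ManinLocalTwoThree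
  (isDiamondChar_of_restrictsFrom eq_zero_of_restrictsFrom towerReduction_holds)

section FineReduction

/-! ### The prime-to-3 base, the cube step and the anti-steps: E-es-94♯ reduced to PAPER THEOREMS + glue
(es g23, MEMO-es §37.9; census HOME/es/g23b/CUBE-ANTI-CENSUS-v1.txt)

All five hypotheses of `fine_reduction` below are THEOREMS ON PAPER (MEMO-es §37.9), each elementary given
(a) Serre's amalgam `SL₂(ℤ[1/3]) = SL₂(ℤ) *_{Γ₀(3)} SL₂(ℤ)^{diag(3,1)}` and Serre's congruence subgroup property for
`SL₂(ℤ[1/3])` (BASE, THEOREM II(t = 3)), (b) the Bass–Serre bound `h ≤ ω` (THEOREM I) with `ω(cube) = ω(K_{3,3}) = 1`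
(two finite computations, two engines), and (c) explicit `2 × 2` matrix identities (verified uniformly by hand and by
script at 81 + 54 + 27 levels):
* THEOREM II(t=3) (`ThreeShiftBasePrimeToThree`): `K₃^grp(N₀) = D^grp(N₀)` and `K₃^-(N₀) = 0` for `3 ∤ N₀`.
* THEOREM IV (`CubeStepDescent`) / IV⁻ (`CubeStepAntiDescent`): for `3 ∤ M` the pair (`Γ₀(M) ∩ Γ⁰(3)`, `Γ₀(3M)`) in
  `Γ₀(M)` reduces mod 3 to the two opposite Borels of `SL₂(𝔽₃)`; coset graph = cube, `ω = 1`; the unique new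
  compatible pair is EXPLICIT: `(0, β_B)` with `β_B(g) = a·b mod 3` on `Γ₀(3M)` (not inflated because
  `Hom(SL₂(𝔽₃), 𝔽₃) = 𝔽₃·σ` and `σ` is non-zero on both Borels).  A new (anti-)invariant class would give
  `w∘conj(diag(3,1)) ∓ w = c·β_B` on `Γ₀(3M)` for a character `w` of `Γ₀(M)`; evaluating at the parabolic
  `P_{1/M} = I + 3(−M, 1; −M², M)` (whose `diag(3,1)`-conjugate generates the stabiliser of the cusp `3/M ∼ ∞` of
  `Γ₀(M)`) gives `w(T) = 0`, and evaluating at `T` gives `c = c·β_B(T) = (3 ∓ 1)·w(T) = 0`.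
* THEOREM V + III″ (`ThreeShiftAntiInvariantDescentAll`): for EVERY `3 ∣ M`, `K₃^-(3M) ⊆ res K₃^-(M)`: the new pair is
  the Heisenberg pair of a lift `m` of `(β, λ)` (the lift exists for every `3 ∣ M`: `β ∪ λ` restricts to zero on every
  elliptic subgroup since `t² = 0` in `H²(ℤ/3; 𝔽₃)`, and `H²` of the free product is the direct sum over them); an
  anti-invariant new class forces `f := w + c·m` with `f(diag(3,1) g diag(3,1)⁻¹) = −f(g)` on `Γ₀(3M)`; on the
  parabolics this reads `π₃^*(μ_f) + π₁^*(μ_f) + c·κ₊ = 0`, and the two-cusp functional `ℓ = ev(P_{2/3}) − ev(P_{1/3})`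
  kills `Im π₁^*` and `Im π₃^*` while `ℓ(κ₊) = 1` (`3 ∥ M`) resp. `2` (`9 ∣ M`) — so `c = 0`.  (Supersedes III′.)
* STEP `3N₀ → 9N₀` for `K₃` (`ThreeShiftStepNine`): `dim K₃(9N₀) ≤ dim res K₃(3N₀) + h ≤ (dim D(9N₀) − 1) + 1` and
  `D ⊆ K₃`, so `K₃(3N₀) = D(3N₀) ⟹ K₃(9N₀) = D(9N₀)` (the one realised obstruction is the conductor-9 diamond
  character).
`fine_reduction` (PROVED below, sorry-free) turns these into E-es-100a, E-es-100b and E-es-99; with THEOREM III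
(`ThreeShiftTowerDescent`) and the glue `TowerReduction` (E-es-101) this is the whole of E-es-94♯. -/

/-- THEOREM II(t = 3) = E-es-102 (paper: Serre's tree + CSP for `SL₂(ℤ[1/3])`): at a level prime to 3 the 3-shift
invariant characters are the diamond characters and there is no non-zero 3-shift anti-invariant character.
TYPER FRAMING (E-es-102, THEOREM II(t = 3)): lens es; proved ON PAPER by es (MEMO-es §37.8–37.9; REF1 §R97 PASS on the structure
theorems), referee R-es-48 PENDING; obligation node until a Lean proof lands, nothing asserted. [conjecture — cell candidate, NOT a tree fact] -/
@[conjecture] def ThreeShiftBasePrimeToThree : Prop :=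
  ∀ N₀ : ℕ, 0 < N₀ → ¬ 3 ∣ N₀ → ThreeShiftInvariantIsDiamondAt N₀ ∧ ThreeShiftAntiInvariantTrivialAt N₀

/-- THEOREM IV = E-es-103 (cube step; paper, MEMO-es §37.9): `K₃^grp(3M) = res K₃^grp(M)` for `3 ∤ M`.
CENSUS: ENGINE 5 Table C, `δ = 0` at 21/21 cube steps; width-divisor formula `∂Δ(p_new) ≡ ±W_{3M}` 15/15.
TYPER FRAMING (E-es-103, THEOREM IV): lens es; proved ON PAPER by es (MEMO-es §37.9), referee R-es-48 PENDING; obligation node,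
nothing asserted. [conjecture — cell candidate, NOT a tree fact] -/
@[conjecture] def CubeStepDescent : Prop :=
  ∀ (M N : ℕ), 0 < M → ¬ 3 ∣ M → N = 3 * M → ∀ φ : Gamma0 N → ZMod 3, IsAddChar φ → IsThreeShiftInvariant φ →
    ∃ w : Gamma0 M → ZMod 3, IsAddChar w ∧ IsThreeShiftInvariant w ∧ RestrictsFrom φ w

/-- THEOREM IV⁻ = E-es-104 (cube anti-step; paper): `K₃^-(3M) ⊆ res K₃^-(M)` for `3 ∤ M`.
TYPER FRAMING (E-es-104, THEOREM IV⁻): lens es; proved ON PAPER by es (MEMO-es §37.9), referee R-es-48 PENDING; obligation node,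
nothing asserted. [conjecture — cell candidate, NOT a tree fact] -/
@[conjecture] def CubeStepAntiDescent : Prop :=
  ∀ (M N : ℕ), 0 < M → ¬ 3 ∣ M → N = 3 * M → ∀ ψ : Gamma0 N → ZMod 3, IsAddChar ψ → IsThreeShiftAntiInvariant ψ →
    ∃ w : Gamma0 M → ZMod 3, IsAddChar w ∧ IsThreeShiftAntiInvariant w ∧ RestrictsFrom ψ w

/-- E-es-105 (paper: `h ≤ ω(K_{3,3}) = 1` at `M = 3N₀` plus a dimension count): the first genuinely 3-adic step for
`K₃`.  CENSUS: ENGINE 5 Table A (`K₃ = r₃` at 198/198 levels) and Table C (`δ = 1`, realised by `χ₉ ∘ d`, at all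
16 steps `3N₀ → 9N₀`).
TYPER FRAMING (E-es-105, STEP NINE): lens es; proved ON PAPER by es (MEMO-es §37.9), referee R-es-48 PENDING; obligation node,
nothing asserted. [conjecture — cell candidate, NOT a tree fact] -/
@[conjecture] def ThreeShiftStepNine : Prop :=
  ∀ N₀ : ℕ, 0 < N₀ → ¬ 3 ∣ N₀ → ThreeShiftInvariantIsDiamondAt (3 * N₀) → ThreeShiftInvariantIsDiamondAt (9 * N₀)

/-- THEOREM V + III″ = E-es-106 (paper, MEMO-es §37.9; supersedes E-es-99): anti-invariant descent
`K₃^-(3M) ⊆ res K₃^-(M)` for EVERY `3 ∣ M`.  CENSUS: `κ₊ ∉ Im(π₁^* + π₃^*)` at 19/19 levels and the uniform value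
`ℓ(κ₊) = 1` (54 levels `3 ∥ M ≤ 243`) resp. `2` (27 levels `9 ∣ M ≤ 243`), HOME/es/g23b/CUBE-ANTI-CENSUS-v1.txt.
TYPER FRAMING (E-es-106, THEOREMS V + III″): lens es; proved ON PAPER by es (MEMO-es §37.9), referee R-es-48 PENDING; obligation
node, nothing asserted. [conjecture — cell candidate, NOT a tree fact] -/
@[conjecture] def ThreeShiftAntiInvariantDescentAll : Prop :=
  ∀ (M N : ℕ), 3 ∣ M → N = 3 * M → ∀ ψ : Gamma0 N → ZMod 3, IsAddChar ψ → IsThreeShiftAntiInvariant ψ →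
    ∃ w : Gamma0 M → ZMod 3, IsAddChar w ∧ IsThreeShiftAntiInvariant w ∧ RestrictsFrom ψ w

/-! #### Glue infrastructure (es; `isDiamondChar_of_restrictsFrom`, `eq_zero_of_restrictsFrom`, `g0Of_entries` are the
tree's, `Theorems/ManinLocalTwoThreeNineShiftTowerReduction.lean`, p3 g10) -/

/-- transitivity of restriction along `L ∣ M ∣ N` (only `M ∣ N` is needed). -/
theorem restrictsFrom_trans {L M N : ℕ} (hMN : M ∣ N) {φ : Gamma0 N → ZMod 3} {w : Gamma0 M → ZMod 3}
    {v : Gamma0 L → ZMod 3} (h1 : RestrictsFrom φ w) (h2 : RestrictsFrom w v) : RestrictsFrom φ v := by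
  intro a b c d hdet hcN hcL
  have hcM : (M : ℤ) ∣ c := dvd_trans (Int.natCast_dvd_natCast.mpr hMN) hcN
  rw [h1 a b c d hdet hcN hcM, h2 a b c d hdet hcM hcL]

/-- **FINE REDUCTION (es g23, PROVED):** the base II(t=3), the cube steps IV / IV⁻, the step `3N₀ → 9N₀` and the
anti-descent V + III″ give the two single-depth statements E-es-100a / E-es-100b of `TowerReduction` and the
anti-descent E-es-99. -/
theorem fine_reduction (hbase : ThreeShiftBasePrimeToThree) (hcube : CubeStepDescent)
    (hcubeA : CubeStepAntiDescent) (hnine : ThreeShiftStepNine) (hanti : ThreeShiftAntiInvariantDescentAll) :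
    ThreeShiftBaseNine ∧ AntiInvariantBaseTwentySeven ∧ ThreeShiftAntiInvariantDescent := by
  refine ⟨?_, ?_, ?_⟩
  · intro N₀ hpos h3
    have hK : ThreeShiftInvariantIsDiamondAt N₀ := (hbase N₀ hpos h3).1
    have h3N : ThreeShiftInvariantIsDiamondAt (3 * N₀) := by
      intro φ hadd hinv
      obtain ⟨w, hwa, hwi, hr⟩ := hcube N₀ (3 * N₀) hpos h3 rfl φ hadd hinv
      exact isDiamondChar_of_restrictsFrom (dvd_mul_left N₀ 3) hr (hK w hwa hwi)
    exact hnine N₀ hpos h3 h3N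
  · intro N₀ hpos h3 ψ hadd hψ
    obtain ⟨w₁, h1a, h1i, r1⟩ := hanti (9 * N₀) (27 * N₀) ⟨3 * N₀, by ring⟩ (by ring) ψ hadd hψ
    obtain ⟨w₂, h2a, h2i, r2⟩ := hanti (3 * N₀) (9 * N₀) ⟨N₀, rfl⟩ (by ring) w₁ h1a h1i
    obtain ⟨w₃, h3a, h3i, r3⟩ := hcubeA N₀ (3 * N₀) hpos h3 rfl w₂ h2a h2i
    have hz : ∀ γ, w₃ γ = 0 := (hbase N₀ hpos h3).2 w₃ h3a h3i
    have r12 : RestrictsFrom ψ w₂ := restrictsFrom_trans ⟨3, by ring⟩ r1 r2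
    have r123 : RestrictsFrom ψ w₃ := restrictsFrom_trans ⟨9, by ring⟩ r12 r3
    exact eq_zero_of_restrictsFrom ⟨27, by ring⟩ r123 hz
  · intro M h27 ψ hadd hψ
    exact hanti M (3 * M) (dvd_trans ⟨9, by norm_num⟩ h27) rfl ψ hadd hψ

/-- Hence E-es-94♯ from the five paper theorems, THEOREM III and the glue E-es-101. -/
theorem nineShiftInvariantIsDiamond_of_fine (hglue : TowerReduction) (hIII : ThreeShiftTowerDescent)
    (hbase : ThreeShiftBasePrimeToThree) (hcube : CubeStepDescent) (hcubeA : CubeStepAntiDescent)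
    (hnine : ThreeShiftStepNine) (hanti : ThreeShiftAntiInvariantDescentAll) : NineShiftInvariantIsDiamond := by
  obtain ⟨h9, h27, hIII'⟩ := fine_reduction hbase hcube hcubeA hnine hanti
  exact hglue hIII hIII' h9 h27

/-- (typer edge) The glue E-es-101 is a THEOREM of the tree (`towerReduction_holds`, p3 g10), so E-es-94♯
`NineShiftInvariantIsDiamond` follows from THEOREM III and the five single-step rows alone — six obligation nodes,
each a paper theorem per es (MEMO-es §37.8–37.9). -/
theorem nineShiftInvariantIsDiamond_of_fine' (hIII : ThreeShiftTowerDescent)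
    (hbase : ThreeShiftBasePrimeToThree) (hcube : CubeStepDescent) (hcubeA : CubeStepAntiDescent)
    (hnine : ThreeShiftStepNine) (hanti : ThreeShiftAntiInvariantDescentAll) : NineShiftInvariantIsDiamond :=
  nineShiftInvariantIsDiamond_of_fine towerReduction_holds hIII hbase hcube hcubeA hnine hanti

end FineReduction

end Summit.BirchSwinnertonDyer.Rank1Residual.ManinAdditive.NineShiftEqualiser
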